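import Summits.HubbardSuperconductivity.HubbardSuperconductivity.Theorems.BalabanIRBirEveryGroundState
import Summits.HubbardSuperconductivity.HubbardSuperconductivity.Theorems.BalabanIRBirEveryGroundStatePencil

/-!
# Route `BalabanIR`, crux 5 `BirEveryGroundState` (item `stmt-HubbardSuperconductivity-2083`):
# the crux IS the structural residue at non-exceptional couplings

The line of the crux card `Cruxes/BirEveryGroundState/Ideas/integer-pencil-schur-residue.md`,
assembled from what is proved in the tree: its selection stub is
`exists_coupling_forall_card_roots_le_hubbardTorus` (every open window of couplings contains ONE
`U` at which, for every torus side `L` at once, the number of distinct eigenvalues of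
`hubbardTorus 2 L 1 U` is maximal over all real couplings — no accidental coincidence of
eigenvalue branches at `U`), and its Schur/transfer stubs are
`birEveryGroundState_of_scalarOnGround`. What is left is the card's residue
`DarkPartnerExclusion` in STRUCTURAL form, typed here as the hypothesis `hdark` of
`birEveryGroundState_of_darkPartnerExclusion`: at every coupling `U > 0` that is
non-exceptional for all `L` (maximal distinct-eigenvalue count for every `L`), eventually in even
`L` the `d`-wave pair structure factor `Δ_d† Δ_d` has scalar matrix elements on the sector ground
eigenspace `E₀(U, L)` — i.e. the permanent ground multiplet at `U` carries no dark partner. With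
it the crux follows; without it nothing in the crux moves (it is engine-free). The hypothesis is
NOT proved here (no printed source decides it; Bruus–Anglès d'Auriac, PRB 55 (1997) 9142, §5
report nondegenerate ground states for `L = 3, 5, 6` and a permanent 3-fold one for `L = 4`).
Everything else is folklore; no definition is introduced.
-/

noncomputable section

namespace Summit.HubbardSuperconductivity.HubbardSuperconductivity.Theorems

open Matrix Finset
open Literature.MathematicalPhysics.QuantumLattice
open Summit.HubbardSuperconductivity.HubbardSuperconductivity.Theses.BalabanIR
open scoped ComplexOrder

/-- **`BirEveryGroundState` ⇐ no dark ground partner at non-exceptional couplings** (the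
line of card `integer-pencil-schur-residue`, closed modulo its single residue). Suppose that for
every doping `δ ∈ (0, 1/2)` and every coupling `U > 0` which is NON-EXCEPTIONAL FOR ALL TORUS
SIDES — the number of distinct eigenvalues of `hubbardTorus 2 L 1 U` is, for every `L`, maximal
over all real couplings — there is a threshold beyond which, at even sides `L`, the pair
structure factor `Δ_d† Δ_d` has scalar matrix elements on the sector ground eigenspace
`E₀(U, L) = szSector N_L 0 ⊓ ker (H - e₀)` (`hdark`, the card's `DarkPartnerExclusion` in
structural form; NOT proved). Then `BirEveryGroundState`: every window `(U₁, U₂) ⊂ (0, ∞)`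
contains such a coupling (`exists_coupling_forall_card_roots_le_hubbardTorus`: the exceptional
couplings of each affine Hermitian pencil `L` are finite, and countably many finite sets miss a
point of the window), where `hdark` supplies the scalar compression and
`birEveryGroundState_of_scalarOnGround` concludes. Kato (1966) Ch. II §1.1; Serre §2.2.
[folklore] -/
theorem birEveryGroundState_of_darkPartnerExclusion
    (hdark : ∀ δ ∈ Set.Ioo (0:ℝ) (1/2), ∀ U : ℝ, 0 < U →
      (∀ (L : ℕ) (u' : ℝ), (hubbardTorus 2 L 1 u').charpoly.roots.toFinset.card ≤
        (hubbardTorus 2 L 1 U).charpoly.roots.toFinset.card) →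
      ∃ L₀ : ℕ, ∀ (L : ℕ) [NeZero L], L₀ ≤ L → Even L →
        let N : ℕ := 2 * ⌊(1 - δ) * (L : ℝ) ^ 2 / 2⌋₊
        let H := hubbardTorus 2 L 1 U
        let S := szSector (Λ := FermionTorus 2 L) N 0
        let E₀ := S ⊓ Module.End.eigenspace (Matrix.toLin' H) ((H.minEnergyOn S : ℝ) : ℂ)
        ∃ μ : ℂ, ∀ v ∈ E₀, ∀ w ∈ E₀,
          star w ⬝ᵥ ((pairField dWaveFormFactor L)ᴴ * pairField dWaveFormFactor L) *ᵥ v =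
            μ * (star w ⬝ᵥ v)) :
    BirEveryGroundState := by
  refine birEveryGroundState_of_scalarOnGround fun δ hδ U₁ U₂ hU₁ hU₁₂ => ?_
  obtain ⟨U, hU, hmax⟩ := exists_coupling_forall_card_roots_le_hubbardTorus hU₁₂
  exact ⟨U, hU, hdark δ hδ U (hU₁.trans hU.1) hmax⟩

end Summit.HubbardSuperconductivity.HubbardSuperconductivity.Theorems
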